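import Mathlib
import Literature.Combinatorics.StablePolynomials.Basic
import Literature.Combinatorics.StablePolynomials.Limits
import Literature.Combinatorics.StablePolynomials.RealRootedRestriction
import Literature.Combinatorics.StablePolynomials.GurvitsCapacityUnivariate
import HarnessLib

/-!
# Gurvits' capacity inequality for the mixed coefficient of a real stable polynomial

Topic `Literature/Combinatorics/StablePolynomials`.  L. Gurvits [Gurvits2008, §2, Theorem ("the main
result": `∂ⁿp/∂x_1⋯∂x_n (0) ≥ ∏_{2≤i≤n} G(min(i, deg_p(i))) Cap(p)` for H-stable `p ∈ Hom_+(n,n)`)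
and its Corollary ("generalized Van der Waerden inequality": `≥ (n!/nⁿ) Cap(p)`)]; exposition
[LaurentSchrijver2010]: for a real polynomial `p` in the variables `z_0, …, z_{n-1}` with
nonnegative coefficients which is real stable (or zero),

  `∂ⁿ p / ∂z_0 ⋯ ∂z_{n-1} ≥ (n!/nⁿ) · Cap(p)`,  `Cap(p) = inf_{x > 0} p(x) / ∏ xᵢ`,

(Gurvits states it for homogeneous `p` of degree `n`, for which upper-half-plane stability —
the tree's `IsRealStable` — and his right-half-plane "H-stability" coincide, `p(iz) = iⁿ p(z)`;
the argument only uses total degree `≤ n`, which is the form proved here, as in Laurent–Schrijver).  We prove it in the pointwise, division-free form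
`Gurvits.factorial_mul_le_pow_mul_coeff_one`: if `c · ∏ xᵢ ≤ p(x)` for all `x ∈ ℝⁿ₊₊` then
`c · n! ≤ nⁿ · [z_0 z_1 ⋯ z_{n-1}] p`.

The proof follows Gurvits 2008, §2.2 ("The Main Idea") and §3–4 literally, peeling off the variable
`z_0` at each step: with `q := (∂p/∂z_0)|_{z_0 = 0}` — here `(finSuccEquiv ℝ k p).coeff 1`, a
polynomial in the remaining `k` variables when `p` has `k + 1` —
* `q = 0` or `q` is real stable (`eq_zero_or_isRealStable_finSuccEquiv_coeff_one`; Gurvits §4.1,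
  Proposition "Let `p ∈ Hom_+(m,n)` be H-Stable. Then the polynomial `q` is either zero or
  H-Stable", there via Gauss–Lucas and a limit argument — in the tree this is
  `IsUpperHalfPlaneStable.pderiv` and `.specialize_real` of `Limits.lean`), `q` has nonnegative
  coefficients and total degree `≤ k`;
* `Cap(q) ≥ ((k/(k+1))^k) · Cap(p)` (`Gurvits.capacity_step`; Gurvits §4, Theorem
  "`Cap(q_{n-1}) ≥ Cap(p) G(deg_p(n))`", from the univariate Lemma of §3 — here
  `Gurvits.coeff_one_ge_of_realRooted` of `GurvitsCapacityUnivariate.lean` — applied to the fibre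
  `R(t) = p(t, y)`, which is real-rooted by `IsRealStable.aeval_line_eq_zero_or_im_eq_zero` of
  `RealRootedRestriction.lean`);
* induction on the number of variables, `∏_{2≤i≤n} G(i) = vdw(n) = n!/nⁿ`, `G(i) = ((i-1)/i)^{i-1}`
  (`Gurvits.factorial_mul_le_pow_mul_coeff_one`; Gurvits §2.2, "If the inequalities
  `Cap(q_{i-1}) ≥ Cap(q_i) G(i)` hold then `∂ⁿp/∂x_1⋯∂x_n (0) = Cap(q_1) ≥ vdw(n) Cap(p)`").

The application to permanents of doubly stochastic matrices (Egorychev–Falikman, van der Waerden's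
conjecture) is `Literature.Combinatorics.Enumerative.VanDerWaerdenPermanent_holds`.

## References

* L. Gurvits, *Van der Waerden/Schrijver–Valiant like conjectures and stable (aka hyperbolic)
  homogeneous polynomials: one theorem for all*, Electron. J. Combin. 15 (2008) R66
  (arXiv:0711.3496): §2 (Definition of `Cap`, `vdw`, `G`; Theorem "main result"; Corollary
  "generalized Van der Waerden inequality"), §2.2 (The Main Idea: the polynomials `q_i` and the
  induction), §3 (univariate Lemma), §4.1 (Proposition: `q` is zero or H-Stable; Theorem:
  `Cap(q_{n-1}) ≥ Cap(p) G(deg_p(n))`). [Gurvits2008]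
* M. Laurent, A. Schrijver, *On Leonid Gurvits's proof for permanents*, Amer. Math. Monthly 117
  (2010) 903–911 (the same proof, streamlined, for polynomials of degree `≤ n` in each step).
  [LaurentSchrijver2010]
-/

noncomputable section

open MvPolynomial
open scoped BigOperators

namespace Literature.Combinatorics.StablePolynomials

/-! ### `finSuccEquiv` bookkeeping: `∂/∂z₀`, change of coefficients, the fibre polynomial -/

/-- `finSuccEquiv` turns `∂/∂z₀` into the derivative of the univariate polynomial in `z₀`
(the `Fin (n+1)` analogue of the tree's `optionEquivLeft_pderiv_none`). [folklore] -/
theorem finSuccEquiv_pderiv_zero {R : Type*} [CommRing R] {n : ℕ}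
    (f : MvPolynomial (Fin (n + 1)) R) :
    finSuccEquiv R n (pderiv 0 f) = Polynomial.derivative (finSuccEquiv R n f) := by
  induction f using MvPolynomial.induction_on with
  | C a => simp [finSuccEquiv_apply]
  | add p q hp hq => simp [hp, hq]
  | mul_X p i hp =>
    rw [pderiv_mul, map_add, map_mul, map_mul, hp, map_mul, Polynomial.derivative_mul]
    refine Fin.cases ?_ (fun j => ?_) i
    · simp [finSuccEquiv_X_zero]
    · simp [finSuccEquiv_X_succ, pderiv_X_of_ne (Fin.succ_ne_zero j)]

/-- `finSuccEquiv` commutes with a change of coefficients, coefficientwise. [folklore] -/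
theorem finSuccEquiv_map_coeff {R S : Type*} [CommSemiring R] [CommSemiring S] (f : R →+* S)
    {n : ℕ} (p : MvPolynomial (Fin (n + 1)) R) (j : ℕ) :
    (finSuccEquiv S n (map f p)).coeff j = map f ((finSuccEquiv R n p).coeff j) := by
  ext m
  rw [finSuccEquiv_coeff_coeff, coeff_map, coeff_map, finSuccEquiv_coeff_coeff]

/-- **The fibre polynomial.**  Freezing the variables `z_{j+1} := x_{j+1}` and keeping `z₀` as the
polynomial variable — the `Polynomial R` `aeval (fun j => if j = 0 then X else C (x j)) p` of
`RealRootedRestriction.lean` — is `finSuccEquiv p` with its coefficients evaluated at the tail of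
`x`. Both sides are `R`-algebra maps in `p`; checked on `C a` and `X j`. [folklore] -/
theorem aeval_ite_zero_eq_map_finSuccEquiv {R : Type*} [CommSemiring R] {n : ℕ}
    (p : MvPolynomial (Fin (n + 1)) R) (x : Fin (n + 1) → R) :
    aeval (fun j : Fin (n + 1) => if j = 0 then (Polynomial.X : Polynomial R)
        else Polynomial.C (x j)) p =
      (finSuccEquiv R n p).map (eval fun i : Fin n => x i.succ) := by
  induction p using MvPolynomial.induction_on with
  | C a => simp [finSuccEquiv_apply]
  | add p q hp hq => simp only [map_add, Polynomial.map_add, hp, hq]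
  | mul_X p j hp =>
    rw [map_mul, map_mul, Polynomial.map_mul, hp, aeval_X]
    congr 1
    refine Fin.cases ?_ (fun i => ?_) j
    · simp [finSuccEquiv_X_zero]
    · simp [finSuccEquiv_X_succ, Fin.succ_ne_zero]

/-- Evaluating a real polynomial with nonnegative coefficients at a nonnegative point gives a
nonnegative value. [folklore] -/
theorem mvPolynomial_eval_nonneg_of_coeff_nonneg {σ : Type*} (q : MvPolynomial σ ℝ) (hq : ∀ m, 0 ≤ q.coeff m)
    (x : σ → ℝ) (hx : ∀ i, 0 ≤ x i) : 0 ≤ eval x q := by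
  rw [eval_eq]
  exact Finset.sum_nonneg fun m _ =>
    mul_nonneg (hq m) (Finset.prod_nonneg fun i _ => pow_nonneg (hx i) _)

/-- The all-ones exponent vector has every coordinate `1`. [folklore] -/
theorem sum_univ_single_one_apply {ι : Type*} [Fintype ι] [DecidableEq ι] (i : ι) :
    (∑ j : ι, Finsupp.single j (1 : ℕ)) i = 1 := by
  rw [Finsupp.finsetSum_apply]
  simp [Finsupp.single_apply]

/-- `Finsupp.cons 1 (z_0 ⋯ z_{k-1}) = z_0 ⋯ z_k` on exponent vectors. [folklore] -/
theorem cons_one_sum_single_one (k : ℕ) :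
    Finsupp.cons 1 (∑ j : Fin k, Finsupp.single j (1 : ℕ)) = ∑ j : Fin (k + 1), Finsupp.single j 1 := by
  ext i
  refine Fin.cases ?_ (fun j => ?_) i
  · rw [Finsupp.cons_zero, sum_univ_single_one_apply]
  · rw [Finsupp.cons_succ, sum_univ_single_one_apply, sum_univ_single_one_apply]

/-! ### Step 1: `(∂p/∂z₀)|_{z₀ = 0}` is zero or real stable -/

/-- **`p ↦ (∂p/∂z₀)|_{z₀ = 0}` preserves real stability (or gives `0`)** (Gurvits 2008, §4.1,
Proposition "`q` is either zero or H-Stable", there via Gauss–Lucas and a limit; here from the tree's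
`IsUpperHalfPlaneStable.pderiv` and `.specialize_real`, i.e. Wagner 2011, Lemma 2.4 (d),(f)): for
real stable `p` in the variables `Fin (k+1)`, the coefficient of `z₀¹` — a polynomial in the
remaining `k` variables — is `0` or real stable.
[cite: Gurvits2008, §4.1 (Proposition: "p H-Stable ⇒ q is either zero or H-Stable")] -/
theorem eq_zero_or_isRealStable_finSuccEquiv_coeff_one {k : ℕ} {p : MvPolynomial (Fin (k + 1)) ℝ}
    (hp : IsRealStable p) :
    (finSuccEquiv ℝ k p).coeff 1 = 0 ∨ IsRealStable ((finSuccEquiv ℝ k p).coeff 1) := by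
  classical
  set P := map (algebraMap ℝ ℂ) p with hP
  have hPst : IsUpperHalfPlaneStable P := hp
  have hev : ∀ z : Fin k → ℂ,
      eval z ((finSuccEquiv ℂ k P).coeff 1) = eval (Fin.cons 0 z) (pderiv 0 P) := by
    intro z
    rw [eval_eq_eval_mv_eval', ← Polynomial.coeff_zero_eq_eval_zero, Polynomial.coeff_map,
      finSuccEquiv_pderiv_zero, Polynomial.coeff_derivative]
    simp
  have hcoe : map (algebraMap ℝ ℂ) ((finSuccEquiv ℝ k p).coeff 1) = (finSuccEquiv ℂ k P).coeff 1 :=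
    (finSuccEquiv_map_coeff _ p 1).symm
  have hupd : ∀ z : Fin k → ℂ,
      (Fin.cons 0 z : Fin (k + 1) → ℂ) = Function.update (Fin.cons Complex.I z) 0 0 := fun z =>
    (Fin.update_cons_zero _ _ _).symm
  -- the specialisation `z₀ := 0` of `∂₀ P`, as a polynomial in all `k + 1` variables
  have hzero : bind₁ (Function.update X 0 (C (0 : ℂ))) (pderiv 0 P) = 0 →
      (finSuccEquiv ℝ k p).coeff 1 = 0 := by
    intro hB
    apply map_injective (algebraMap ℝ ℂ) (RingHom.injective _)
    rw [hcoe, map_zero]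
    apply MvPolynomial.funext
    intro z
    rw [hev, map_zero, hupd, ← eval_bind₁_update, hB, map_zero]
  rcases hPst.pderiv 0 with h0 | hst
  · left
    apply hzero
    rw [h0, map_zero]
  · rcases hst.specialize_real 0 0 with hB0 | hBst
    · left
      apply hzero
      simpa using hB0
    · right
      change IsUpperHalfPlaneStable (map (algebraMap ℝ ℂ) ((finSuccEquiv ℝ k p).coeff 1))
      rw [hcoe]
      intro z hz
      rw [hev, hupd, ← eval_bind₁_update]
      simp only [Complex.ofReal_zero] at hBst
      exact hBst _ fun i => Fin.cases (by simp) (fun j => by simpa using hz j) i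

namespace Gurvits

/-! ### Step 2: the capacity of `(∂p/∂z₀)|_{z₀ = 0}` (Gurvits 2008, §4, Theorem) -/

/-- **Gurvits' capacity step** (Gurvits 2008, §4, Theorem "`Cap(q_{n-1}) ≥ Cap(p) G(deg_p(n))`";
`G` is non-increasing, and the padded AM–GM in `coeff_one_ge_of_realRooted` gives the bound with
`G(K)` for any `K ≥ deg R` directly, used here with `K = k + 1`).  Let `p ∈ ℝ[z_0, …, z_k]` have
nonnegative coefficients, total degree `≤ k + 1`, be `0` or
real stable, and satisfy `c · ∏ᵢ xᵢ ≤ p(x)` for all `x > 0`.  Then `q := (∂p/∂z₀)|_{z₀=0}`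
(`= (finSuccEquiv ℝ k p).coeff 1`) satisfies `c · (k/(k+1))^k · ∏ᵢ yᵢ ≤ q(y)` for all `y > 0`.
Proof: the fibre `R(t) := p(t, y)` has nonnegative coefficients, degree `≤ k + 1`, only real roots
(`IsRealStable.aeval_line_eq_zero_or_im_eq_zero`), `R'(0) = q(y)` and `(c ∏ yᵢ) · t ≤ R(t)`;
apply the univariate lemma `coeff_one_ge_of_realRooted` with `K = k + 1`.
[cite: Gurvits2008, §4 (Theorem: "Cap(q_{n-1}) ≥ Cap(p) G(deg_p(n))")] -/
theorem capacity_step {k : ℕ} {p : MvPolynomial (Fin (k + 1)) ℝ} (hcoef : ∀ m, 0 ≤ coeff m p)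
    (hdeg : p.totalDegree ≤ k + 1) (hst : p = 0 ∨ IsRealStable p) {c : ℝ}
    (hcap : ∀ x : Fin (k + 1) → ℝ, (∀ i, 0 < x i) → c * ∏ i, x i ≤ eval x p)
    {y : Fin k → ℝ} (hy : ∀ i, 0 < y i) :
    c * ((k : ℝ) / ((k : ℝ) + 1)) ^ k * ∏ i, y i ≤ eval y ((finSuccEquiv ℝ k p).coeff 1) := by
  set q := (finSuccEquiv ℝ k p).coeff 1 with hq
  -- coefficients of the `finSuccEquiv`-coefficients are coefficients of `p`
  have hqc : ∀ j m, 0 ≤ coeff m ((finSuccEquiv ℝ k p).coeff j) := fun j m => by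
    rw [finSuccEquiv_coeff_coeff]; exact hcoef _
  have hq0 : 0 ≤ eval y q := mvPolynomial_eval_nonneg_of_coeff_nonneg q (hqc 1) y fun i => (hy i).le
  have hprod : 0 < ∏ i, y i := Finset.prod_pos fun i _ => hy i
  have hG : 0 ≤ ((k : ℝ) / ((k : ℝ) + 1)) ^ k := by positivity
  rcases le_or_gt c 0 with hc | hc
  · exact le_trans (mul_nonpos_of_nonpos_of_nonneg (mul_nonpos_of_nonpos_of_nonneg hc hG) hprod.le)
      hq0
  -- `c > 0`, so `p ≠ 0` and `p` is real stable
  have hp0 : p ≠ 0 := by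
    intro h
    have := hcap (fun _ => 1) fun _ => one_pos
    rw [h, map_zero] at this
    simp only [Finset.prod_const_one, mul_one] at this
    linarith
  have hpst : IsRealStable p := hst.resolve_left hp0
  -- the fibre polynomial `R(t) = p(t, y)`
  set R : Polynomial ℝ := (finSuccEquiv ℝ k p).map (eval y) with hR
  have hReval : ∀ t : ℝ, R.eval t = eval (Fin.cons t y : Fin (k + 1) → ℝ) p := fun t =>
    (eval_eq_eval_mv_eval' y t p).symm
  have hRcoef : ∀ j, 0 ≤ R.coeff j := fun j => by
    rw [hR, Polynomial.coeff_map]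
    exact mvPolynomial_eval_nonneg_of_coeff_nonneg _ (hqc j) y fun i => (hy i).le
  have hRcoef1 : R.coeff 1 = eval y q := by rw [hR, Polynomial.coeff_map]
  have hRdeg : R.natDegree ≤ k + 1 :=
    (Polynomial.natDegree_map_le).trans
      ((natDegree_finSuccEquiv p).trans_le ((degreeOf_le_totalDegree p 0).trans hdeg))
  have hRcap : ∀ t : ℝ, 0 < t → c * (∏ i, y i) * t ≤ R.eval t := by
    intro t ht
    have h := hcap (Fin.cons t y) fun i => Fin.cases (by simpa using ht) (fun j => by simpa using hy j) i
    rw [Fin.prod_univ_succ] at h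
    simp only [Fin.cons_zero, Fin.cons_succ] at h
    rw [hReval]
    linarith [h]
  -- `R` is the coordinate-line restriction of `p` through the real point `(0, y)`; real-rooted
  have hline := hpst.aeval_line_eq_zero_or_im_eq_zero (Fin.cons 0 y) 0
  rw [aeval_ite_zero_eq_map_finSuccEquiv] at hline
  simp only [Fin.cons_succ] at hline
  change R = 0 ∨ ∀ t : ℂ, (R.map (algebraMap ℝ ℂ)).eval t = 0 → t.im = 0 at hline
  have hRroots : ∀ t : ℂ, (R.map (algebraMap ℝ ℂ)).eval t = 0 → t.im = 0 := by
    refine hline.resolve_left fun hR0 => ?_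
    have := hRcap 1 one_pos
    rw [hR0, Polynomial.eval_zero, mul_one] at this
    linarith [mul_pos hc hprod]
  -- the univariate lemma with `K = k + 1`
  have key := coeff_one_ge_of_realRooted (k + 1) R (c * ∏ i, y i) (by omega) hRdeg hRcoef hRroots
    hRcap
  rw [hRcoef1] at key
  have hcast : ((k + 1 : ℕ) : ℝ) - 1 = k := by push_cast; ring
  rw [hcast, Nat.add_sub_cancel] at key
  calc c * ((k : ℝ) / ((k : ℝ) + 1)) ^ k * ∏ i, y i
      = c * (∏ i, y i) * ((k : ℝ) / ((k + 1 : ℕ) : ℝ)) ^ k := by push_cast; ring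
    _ ≤ eval y q := key

/-! ### Step 3: induction on the number of variables (Gurvits 2008, §2 Theorem, §2.2) -/

/-- The arithmetic of one induction step: from `c (k/(k+1))^k · k! ≤ k^k X` to
`c (k+1)! ≤ (k+1)^{k+1} X`. [folklore] -/
theorem vdW_step_arith (k : ℕ) (c X : ℝ)
    (h : c * ((k : ℝ) / ((k : ℝ) + 1)) ^ k * (k.factorial : ℝ) ≤ (k : ℝ) ^ k * X) :
    c * ((k + 1).factorial : ℝ) ≤ ((k : ℝ) + 1) ^ (k + 1) * X := by
  have hk1 : (0 : ℝ) < (k : ℝ) + 1 := by positivity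
  rw [div_pow] at h
  rcases Nat.eq_zero_or_pos k with rfl | hk
  · simp at h ⊢
    linarith
  have hkk : (0 : ℝ) < (k : ℝ) ^ k := by positivity
  have hK : (0 : ℝ) < ((k : ℝ) + 1) ^ k := by positivity
  have h1 : c * (k.factorial : ℝ) ≤ ((k : ℝ) + 1) ^ k * X := by
    have h2 : c * (k.factorial : ℝ) / ((k : ℝ) + 1) ^ k * (k : ℝ) ^ k ≤ X * (k : ℝ) ^ k := by
      calc c * (k.factorial : ℝ) / ((k : ℝ) + 1) ^ k * (k : ℝ) ^ k
          = c * ((k : ℝ) ^ k / ((k : ℝ) + 1) ^ k) * (k.factorial : ℝ) := by ring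
        _ ≤ (k : ℝ) ^ k * X := h
        _ = X * (k : ℝ) ^ k := mul_comm _ _
    have h3 := le_of_mul_le_mul_right h2 hkk
    rw [div_le_iff₀ hK] at h3
    linarith [h3]
  rw [Nat.factorial_succ, Nat.cast_mul, pow_succ]
  push_cast
  nlinarith [h1]

/-- **Gurvits' theorem, pointwise capacity form** (Gurvits 2008, §2, Theorem "the main result" and
Corollary "generalized Van der Waerden inequality" `∂ⁿp/∂x_1⋯∂x_n (0) ≥ (n!/nⁿ) Cap(p)`, with the
induction of §2.2 and `∏_{2 ≤ i ≤ n} G(i) = vdw(n) = n!/nⁿ`, `G(i) = ((i-1)/i)^{i-1}`;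
Laurent–Schrijver 2010).  Let `p ∈ ℝ[z_0, …, z_{n-1}]` have nonnegative coefficients and
total degree `≤ n`, be `0` or real stable, and satisfy `c · ∏ᵢ xᵢ ≤ p(x)` for all `x ∈ ℝⁿ₊₊`
(i.e. `Cap(p) ≥ c`).  Then the mixed coefficient satisfies `c · n! ≤ nⁿ · [z_0 ⋯ z_{n-1}] p`, i.e.
`∂ⁿp/∂z_0⋯∂z_{n-1} ≥ (n!/nⁿ) Cap(p)`. Induction on `n` via `capacity_step`.
[cite: Gurvits2008, §2 (Corollary: "generalized Van der Waerden inequality")] -/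
theorem factorial_mul_le_pow_mul_coeff_one :
    ∀ (n : ℕ) (p : MvPolynomial (Fin n) ℝ), (∀ m, 0 ≤ coeff m p) → p.totalDegree ≤ n →
      (p = 0 ∨ IsRealStable p) →
      ∀ c : ℝ, (∀ x : Fin n → ℝ, (∀ i, 0 < x i) → c * ∏ i, x i ≤ eval x p) →
        c * (n.factorial : ℝ) ≤ (n : ℝ) ^ n * coeff (∑ j : Fin n, Finsupp.single j 1) p := by
  intro n
  induction n with
  | zero =>
    intro p _ _ _ c hcap
    have h := hcap Fin.elim0 fun i => i.elim0
    have hp : p = C (coeff 0 p) := eq_C_of_isEmpty p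
    rw [hp, eval_C] at h
    simp only [Finset.univ_eq_empty, Finset.prod_empty, mul_one] at h
    simpa using h
  | succ k ih =>
    intro p hcoef hdeg hst c hcap
    set q := (finSuccEquiv ℝ k p).coeff 1 with hq
    have hqcoef : ∀ m, 0 ≤ coeff m q := fun m => by
      rw [hq, finSuccEquiv_coeff_coeff]; exact hcoef _
    have hqdeg : q.totalDegree ≤ k := by
      by_cases hq0 : q = 0
      · rw [hq0, totalDegree_zero]; exact Nat.zero_le _
      · have := totalDegree_coeff_finSuccEquiv_add_le p 1 hq0
        rw [← hq] at this
        omega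
    have hqst : q = 0 ∨ IsRealStable q := by
      rcases hst with h0 | hst
      · left; rw [hq, h0, map_zero, Polynomial.coeff_zero]
      · exact eq_zero_or_isRealStable_finSuccEquiv_coeff_one hst
    have hqcap : ∀ y : Fin k → ℝ, (∀ i, 0 < y i) →
        c * ((k : ℝ) / ((k : ℝ) + 1)) ^ k * ∏ i, y i ≤ eval y q := fun y hy =>
      capacity_step hcoef hdeg hst hcap hy
    have key := ih q hqcoef hqdeg hqst _ hqcap
    have hcoeff : coeff (∑ j : Fin k, Finsupp.single j 1) q =
        coeff (∑ j : Fin (k + 1), Finsupp.single j 1) p := by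
      rw [hq, finSuccEquiv_coeff_coeff, cons_one_sum_single_one]
    rw [hcoeff] at key
    push_cast
    exact vdW_step_arith k c _ key

end Gurvits

end Literature.Combinatorics.StablePolynomials

end
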